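import Mathlib
import Summits.ResolutionOfSingularities.ResolutionOfSingularities.Theorems.HomologicalConductorPersistenceDoubleCoverDescent
import Summits.ResolutionOfSingularities.ResolutionOfSingularities.Theorems.HomologicalConductorPersistenceKC3LowerMiddle
import Summits.ResolutionOfSingularities.ResolutionOfSingularities.Theorems.HomologicalConductorPersistenceJacobianKept
import HarnessLib

/-!
# Crux `Persistence` (stmt-ResolutionOfSingularities-16484) / rung S-2 — DESCENT of `ca` along the `m`-BRANCHED COVER `S[y]/(yᵐ + f) → S/(f)`
# (the instance of `…PersistenceDoubleCoverDescent`: the coefficient maps `ε, λ` of `AdjoinRoot (Xᵐ + C f)`)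

Route `ResolutionOfSingularities/HomologicalConductor`, chain W4.4b (cell `res-hironaka`).  `[OURS · L1 w44b · res-L1-w44b-stub-2 gen 4]`; NOT a
statement of the manuscript under review (Hironaka 2017), no statement of that manuscript is used; AI-written, weaker than expert review.

`S` noetherian, `f ∈ S`, `m ≥ 2`, `T = AdjoinRoot (Xᵐ + C f) = S[y]/(yᵐ + f)`, `y = root`.  With `ε := coeff₀ ∘ modByMonic`,
`λ := coeff₁ ∘ modByMonic` (`AdjoinRoot.modByMonicHom`): (A1) `r − ε(r)·1 ∈ (y)` and (A2) `λ(y r) = ε(r)` (`coeff₁(yᵐ + f) = 0` as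
`m ≥ 2`); `y ∈ T⁰` when `f ∈ S⁰`.  Hence (`…DoubleCoverDescent`, p546201):

* **`map_cohomologyAnnihilatorOfDegree_le`**: `(caⁿ⁺²(T)).map (T → T/(y)) ≤ caⁿ⁺¹(T/(y))`; `ca`-form;
* **`map_cohomologyAnnihilatorOfDegree_le_quotient`**: along the natural surjection `T ↠ S/(f)` (`y ↦ 0`):
  `(caⁿ⁺²(S[y]/(yᵐ+f))).map π ≤ caⁿ⁺¹(S/(f))` — Esentepe 2020 Thm 5.4, FIRST SENTENCE, for every `m ≥ 2`, every noetherian `S`, every `f ∈ S⁰`,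
  no characteristic hypothesis, no matrix factorisations (the tree's named fact `branchedCover_map_cohomologyAnnihilator_le` is the
  power-series-typed version of this for `S = k⟦x⟧`).

References (mechanism only): Ö. Esentepe, J. Algebra 541 (2020) Thm 5.4 [`Esentepe2020`]; H. Knörrer, Invent. Math. 88 (1987).
-/

noncomputable section

-- single-problem summit: the doubled namespace component `ResolutionOfSingularities` is forced
set_option linter.dupNamespace false

namespace Summit.ResolutionOfSingularities.ResolutionOfSingularities.Theorems.HomologicalConductor.BranchedCoverDescent

open Polynomial Literature.RingTheory.CohomologyAnnihilator
open Summit.ResolutionOfSingularities.ResolutionOfSingularities.Theorems.HomologicalConductor.DoubleCoverDescent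
open Summit.ResolutionOfSingularities.ResolutionOfSingularities.Theorems.HomologicalConductor.KC3Lower
open Summit.ResolutionOfSingularities.ResolutionOfSingularities.Theorems.HomologicalConductor
open scoped nonZeroDivisors

universe u

variable {S : Type u} [CommRing S]

/-! ## §1 The coefficient maps of `AdjoinRoot (Xᵐ + C f)` -/

/-- `Xᵐ + C f` is monic. [folklore] -/
theorem monic_gen (f : S) {m : ℕ} (hm : 2 ≤ m) : (X ^ m + C f : S[X]).Monic :=
  monic_X_pow_add_C f (by omega)

/-- `natDegree (Xᵐ + C f) = m` (in a nontrivial ring). [folklore] -/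
theorem natDegree_gen [Nontrivial S] (f : S) {m : ℕ} (_hm : 2 ≤ m) : (X ^ m + C f : S[X]).natDegree = m :=
  natDegree_X_pow_add_C

/-- `coeff₁ (Xᵐ + C f) = 0` for `m ≥ 2`. [folklore] -/
theorem coeff_one_gen (f : S) {m : ℕ} (hm : 2 ≤ m) : (X ^ m + C f : S[X]).coeff 1 = 0 := by
  rw [coeff_add, coeff_X_pow, if_neg (by omega), coeff_C, if_neg one_ne_zero, add_zero]

/-- (A1) for `T = AdjoinRoot g`, `g` monic: `r − (coeff₀ of the canonical representative)·1 ∈ (root g)`. [folklore] -/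
theorem sub_algebraMap_coeff_zero_mem {g : S[X]} (hg : g.Monic) (r : AdjoinRoot g) :
    r - algebraMap S (AdjoinRoot g) (((lcoeff S 0).comp (AdjoinRoot.modByMonicHom hg)) r) ∈
      Ideal.span {AdjoinRoot.root g} := by
  obtain ⟨q, rfl⟩ := AdjoinRoot.mk_surjective r
  rw [LinearMap.comp_apply, lcoeff_apply, AdjoinRoot.algebraMap_eq, AdjoinRoot.modByMonicHom_mk]
  have hq : AdjoinRoot.mk g q = AdjoinRoot.mk g (q %ₘ g) := by
    rw [AdjoinRoot.mk_eq_mk]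
    exact ⟨q /ₘ g, by linear_combination -(modByMonic_add_div q g)⟩
  have hdecomp : AdjoinRoot.mk g (q %ₘ g) = AdjoinRoot.root g * AdjoinRoot.mk g (q %ₘ g).divX +
      AdjoinRoot.of g ((q %ₘ g).coeff 0) := by
    conv_lhs => rw [← X_mul_divX_add (q %ₘ g)]
    rw [map_add, map_mul, AdjoinRoot.mk_X, AdjoinRoot.mk_C]
  rw [hq, hdecomp, add_sub_cancel_right]
  exact Ideal.mul_mem_right _ _ (Ideal.mem_span_singleton_self _)

/-- For `p` of degree `< m` (`m ≥ 1`): `(X·p) %ₘ (Xᵐ + C f) = X·p − C(coeff_{m−1} p)·(Xᵐ + C f)`. [folklore] -/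
theorem X_mul_modByMonic [Nontrivial S] (f : S) {m : ℕ} (hm : 2 ≤ m) (p : S[X]) (hp : p.natDegree < m) :
    (X * p) %ₘ (X ^ m + C f : S[X]) = X * p - C (p.coeff (m - 1)) * (X ^ m + C f) := by
  have hg := monic_gen f hm
  refine (div_modByMonic_unique (C (p.coeff (m - 1))) _ hg ⟨by ring, ?_⟩).2
  rw [Polynomial.degree_eq_natDegree hg.ne_zero, natDegree_gen f hm, degree_lt_iff_coeff_zero]
  intro k hk
  have hk' : m ≤ k := by exact_mod_cast hk
  obtain ⟨k', rfl⟩ : ∃ k', k = k' + 1 := ⟨k - 1, by omega⟩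
  rw [coeff_sub, coeff_X_mul, coeff_C_mul, coeff_add, coeff_X_pow, coeff_C_succ, add_zero]
  by_cases hkm : k' + 1 = m
  · rw [if_pos hkm, mul_one, show k' = m - 1 by omega, sub_self]
  · rw [if_neg hkm, mul_zero, sub_zero]
    exact coeff_eq_zero_of_natDegree_lt (by omega)

/-- (A2) for `T = AdjoinRoot (Xᵐ + C f)`, `m ≥ 2`: `coeff₁(rep (y·r)) = coeff₀(rep r)`. [folklore] -/
theorem coeff_one_root_mul [Nontrivial S] (f : S) {m : ℕ} (hm : 2 ≤ m) (r : AdjoinRoot (X ^ m + C f : S[X])) :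
    ((lcoeff S 1).comp (AdjoinRoot.modByMonicHom (monic_gen f hm))) (AdjoinRoot.root (X ^ m + C f : S[X]) * r) =
      ((lcoeff S 0).comp (AdjoinRoot.modByMonicHom (monic_gen f hm))) r := by
  have hg := monic_gen f hm
  obtain ⟨q, rfl⟩ := AdjoinRoot.mk_surjective r
  set p := q %ₘ (X ^ m + C f : S[X]) with hp
  have hq : AdjoinRoot.mk (X ^ m + C f : S[X]) q = AdjoinRoot.mk _ p := by
    rw [AdjoinRoot.mk_eq_mk]
    exact ⟨q /ₘ (X ^ m + C f), by rw [hp]; linear_combination -(modByMonic_add_div q (X ^ m + C f : S[X]))⟩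
  have hpdeg : p.natDegree < m := by
    have h := natDegree_modByMonic_lt q hg (by
      intro h1
      have := congrArg natDegree h1
      rw [natDegree_gen f hm, natDegree_one] at this
      omega)
    rwa [natDegree_gen f hm] at h
  have hpp : p %ₘ (X ^ m + C f : S[X]) = p := by
    rw [hp]
    exact (modByMonic_eq_self_iff hg).mpr (degree_modByMonic_lt q hg)
  rw [LinearMap.comp_apply, LinearMap.comp_apply, lcoeff_apply, lcoeff_apply, hq, ← AdjoinRoot.mk_X, ← map_mul,
    AdjoinRoot.modByMonicHom_mk, AdjoinRoot.modByMonicHom_mk, hpp, X_mul_modByMonic f hm p hpdeg, coeff_sub, coeff_X_mul,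
    coeff_C_mul, coeff_one_gen f hm, mul_zero, sub_zero]

/-- `root ∈ T⁰` when `f ∈ S⁰` (`Xᵐ + C f ≡ f mod X`). [folklore] -/
theorem root_mem_nonZeroDivisors (f : S) (hf : f ∈ S⁰) {m : ℕ} (hm : 2 ≤ m) :
    AdjoinRoot.root (X ^ m + C f : S[X]) ∈ (AdjoinRoot (X ^ m + C f : S[X]))⁰ := by
  have hX : (X : S[X]) ∈ (S[X])⁰ := mem_nonZeroDivisors_iff_right.mpr fun q hq => by
    ext k
    have := congrArg (fun r : S[X] => r.coeff (k + 1)) hq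
    simpa [coeff_mul_X] using this
  have hc : constantCoeff (X ^ m + C f : S[X]) = f := by
    rw [constantCoeff_apply, coeff_add, coeff_X_pow, if_neg (by omega), coeff_C_zero, zero_add]
  have h := mk_mem_nonZeroDivisors_of_ringHom (S := S[X]) (T := S) (constantCoeff : S[X] →+* S) (a := X)
    (f := (X ^ m + C f : S[X])) hX (by simp) (fun q hq => X_dvd_iff.mpr hq) (by rw [hc]; exact hf)
  exact h

/-! ## §2 Descent along `T → T/(y)` and along `T ↠ S/(f)` -/

/-- **Descent for the `m`-branched cover, quotient form**: `S` noetherian (nontrivial), `f ∈ S⁰`, `m ≥ 2`, `T = S[y]/(yᵐ + f)`: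
`(caⁿ⁺²(T)).map (T → T/(y)) ≤ caⁿ⁺¹(T/(y))`. [OURS · L1 w44b] -/
theorem map_cohomologyAnnihilatorOfDegree_le [IsNoetherianRing S] [Nontrivial S] (f : S) (hf : f ∈ S⁰) {m : ℕ} (hm : 2 ≤ m) (n : ℕ) :
    (cohomologyAnnihilatorOfDegree (AdjoinRoot (X ^ m + C f : S[X])) (n + 2)).map
        (Ideal.Quotient.mk (Ideal.span {AdjoinRoot.root (X ^ m + C f : S[X])})) ≤
      cohomologyAnnihilatorOfDegree (AdjoinRoot (X ^ m + C f : S[X]) ⧸ Ideal.span {AdjoinRoot.root (X ^ m + C f : S[X])}) (n + 1) :=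
  DoubleCoverDescent.map_cohomologyAnnihilatorOfDegree_le (root_mem_nonZeroDivisors f hf hm)
    ((lcoeff S 0).comp (AdjoinRoot.modByMonicHom (monic_gen f hm)))
    ((lcoeff S 1).comp (AdjoinRoot.modByMonicHom (monic_gen f hm)))
    (sub_algebraMap_coeff_zero_mem (monic_gen f hm)) (coeff_one_root_mul f hm) n

/-- The natural surjection `π : S[y]/(yᵐ + f) ↠ S/(f)`, `y ↦ 0`, has kernel `(y)`. [folklore] -/
theorem ker_lift_eq (f : S) {m : ℕ} (hm : 2 ≤ m) :
    RingHom.ker (AdjoinRoot.lift (Ideal.Quotient.mk (Ideal.span {f})) (0 : S ⧸ Ideal.span {f})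
        (by rw [eval₂_add, eval₂_X_pow, eval₂_C, zero_pow (by omega), zero_add,
              Ideal.Quotient.eq_zero_iff_mem]; exact Ideal.mem_span_singleton_self f) :
          AdjoinRoot (X ^ m + C f : S[X]) →+* S ⧸ Ideal.span {f}) =
      Ideal.span {AdjoinRoot.root (X ^ m + C f : S[X])} := by
  apply le_antisymm
  · intro u hu
    obtain ⟨p, rfl⟩ := AdjoinRoot.mk_surjective u
    rw [RingHom.mem_ker, AdjoinRoot.lift_mk, eval₂_eq_eval_map, ← coeff_zero_eq_eval_zero, coeff_map,
      Ideal.Quotient.eq_zero_iff_mem, Ideal.mem_span_singleton'] at hu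
    obtain ⟨s, hs⟩ := hu
    -- `p = X·divX p + C(p₀) = X·divX p + C s · f = X·(divX p − C s·X^{m−1}) + C s·(Xᵐ + C f)`
    have hp : p = X * (p.divX - C s * X ^ (m - 1)) + C s * (X ^ m + C f) := by
      conv_lhs => rw [← X_mul_divX_add p, ← hs, C_mul]
      have : (X : S[X]) ^ m = X * X ^ (m - 1) := by rw [← pow_succ']; congr 1; omega
      rw [this]; ring
    rw [hp, map_add, map_mul, AdjoinRoot.mk_X, map_mul, AdjoinRoot.mk_self, mul_zero, add_zero]
    exact Ideal.mul_mem_right _ _ (Ideal.mem_span_singleton_self _)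
  · rw [Ideal.span_le, Set.singleton_subset_iff, SetLike.mem_coe, RingHom.mem_ker, AdjoinRoot.lift_root]

/-- **Descent for the `m`-branched cover along `π : S[y]/(yᵐ + f) ↠ S/(f)`** (Esentepe 2020 Thm 5.4, first sentence, fact-free for
every `m ≥ 2`, every noetherian nontrivial `S`, `f ∈ S⁰`): `(caⁿ⁺²(S[y]/(yᵐ + f))).map π ≤ caⁿ⁺¹(S/(f))`. [OURS · L1 w44b] -/
theorem map_cohomologyAnnihilatorOfDegree_le_quotient [IsNoetherianRing S] [Nontrivial S] (f : S) (hf : f ∈ S⁰) {m : ℕ} (hm : 2 ≤ m)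
    (n : ℕ) :
    (cohomologyAnnihilatorOfDegree (AdjoinRoot (X ^ m + C f : S[X])) (n + 2)).map
        (AdjoinRoot.lift (Ideal.Quotient.mk (Ideal.span {f})) (0 : S ⧸ Ideal.span {f})
          (by rw [eval₂_add, eval₂_X_pow, eval₂_C, zero_pow (by omega), zero_add,
                Ideal.Quotient.eq_zero_iff_mem]; exact Ideal.mem_span_singleton_self f)) ≤
      cohomologyAnnihilatorOfDegree (S ⧸ Ideal.span {f}) (n + 1) := by
  set π := (AdjoinRoot.lift (Ideal.Quotient.mk (Ideal.span {f})) (0 : S ⧸ Ideal.span {f})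
    (by rw [eval₂_add, eval₂_X_pow, eval₂_C, zero_pow (by omega), zero_add,
          Ideal.Quotient.eq_zero_iff_mem]; exact Ideal.mem_span_singleton_self f) :
      AdjoinRoot (X ^ m + C f : S[X]) →+* S ⧸ Ideal.span {f}) with hπ
  have hsurj : Function.Surjective π := fun u => by
    obtain ⟨s, rfl⟩ := Ideal.Quotient.mk_surjective u
    exact ⟨AdjoinRoot.of _ s, by rw [hπ, AdjoinRoot.lift_of]⟩
  have hker : RingHom.ker π = Ideal.span {AdjoinRoot.root (X ^ m + C f : S[X])} := ker_lift_eq f hm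
  -- `T/(y) ≃ S/(f)` and transport
  let e : (AdjoinRoot (X ^ m + C f : S[X]) ⧸ Ideal.span {AdjoinRoot.root (X ^ m + C f : S[X])}) ≃+* S ⧸ Ideal.span {f} :=
    (Ideal.quotEquivOfEq hker.symm).trans (RingHom.quotientKerEquivOfSurjective hsurj)
  have he : (e : _ ≃+* _).toRingHom.comp (Ideal.Quotient.mk _) = π := by
    refine RingHom.ext fun u => ?_
    obtain ⟨q, rfl⟩ := AdjoinRoot.mk_surjective u
    simp only [RingHom.comp_apply, RingEquiv.toRingHom_eq_coe, RingEquiv.coe_toRingHom, e, RingEquiv.trans_apply,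
      Ideal.quotEquivOfEq_mk, RingHom.quotientKerEquivOfSurjective_apply_mk]
  rw [← he, ← Ideal.map_map]
  refine (Ideal.map_mono (map_cohomologyAnnihilatorOfDegree_le f hf hm n)).trans ?_
  rw [RingEquiv.toRingHom_eq_coe, map_ringEquiv_cohomologyAnnihilatorOfDegree e (n + 1)]

/-- `ca`-form along `π`: `(ca(S[y]/(yᵐ + f))).map π ≤ ca(S/(f))`. [OURS · L1 w44b] -/
theorem map_cohomologyAnnihilator_le_quotient [IsNoetherianRing S] [Nontrivial S] (f : S) (hf : f ∈ S⁰) {m : ℕ} (hm : 2 ≤ m) :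
    (cohomologyAnnihilator (AdjoinRoot (X ^ m + C f : S[X]))).map
        (AdjoinRoot.lift (Ideal.Quotient.mk (Ideal.span {f})) (0 : S ⧸ Ideal.span {f})
          (by rw [eval₂_add, eval₂_X_pow, eval₂_C, zero_pow (by omega), zero_add,
                Ideal.Quotient.eq_zero_iff_mem]; exact Ideal.mem_span_singleton_self f)) ≤
      cohomologyAnnihilator (S ⧸ Ideal.span {f}) := by
  rw [Ideal.map_le_iff_le_comap]
  intro c hc
  obtain ⟨n, hn⟩ := mem_cohomologyAnnihilator_iff.mp hc
  have hc' := cohomologyAnnihilatorOfDegree_mono (show n ≤ n + 2 by omega) hn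
  exact cohomologyAnnihilatorOfDegree_le (n + 1)
    ((Ideal.map_le_iff_le_comap.mp (map_cohomologyAnnihilatorOfDegree_le_quotient f hf hm n)) hc')

/-! ## §3 (rev 2) The double cover `m = 2`: both halves — `ca(S[y]/(y² + f)) = π⁻¹(ca(S/(f)))` -/

/-- `y ∈ caᵈ⁺¹(S[y]/(y² + f))` when `2` is a unit of `S` and `caᵈ⁺²(S[X]) = ⊤` (e.g. `S` regular of dimension `≤ d`):
`∂_y(y² + f) = 2y` and KEPT-PROPER (p522421). [folklore] -/
theorem root_mem_cohomologyAnnihilatorOfDegree [IsNoetherianRing S] (f : S) {d : ℕ}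
    (hSX : cohomologyAnnihilatorOfDegree (Polynomial S) (d + 2) = ⊤) (h2 : IsUnit (2 : S)) :
    AdjoinRoot.root (X ^ 2 + C f : S[X]) ∈ cohomologyAnnihilatorOfDegree (AdjoinRoot (X ^ 2 + C f : S[X])) (d + 1) := by
  have h := PersistenceJacobianKept.derivation_mem_cohomologyAnnihilatorOfDegree (A := S) hSX (X ^ 2 + C f : S[X])
    ((monic_gen f le_rfl).mem_nonZeroDivisors) derivative'
  have hD : (derivative' : Derivation S S[X] S[X]) (X ^ 2 + C f : S[X]) = C 2 * X := by
    rw [derivative'_apply, derivative_add, derivative_X_sq, derivative_C, add_zero]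
  rw [hD] at h
  obtain ⟨u, hu⟩ := h2
  have h' : Ideal.Quotient.mk (Ideal.span {(X ^ 2 + C f : S[X])}) (C (↑u⁻¹ : S) * (C 2 * X)) ∈
      cohomologyAnnihilatorOfDegree (AdjoinRoot (X ^ 2 + C f : S[X])) (d + 1) := by
    rw [map_mul]
    exact Ideal.mul_mem_left _ _ h
  have hX : C (↑u⁻¹ : S) * (C 2 * X) = (X : S[X]) := by
    rw [← mul_assoc, ← C_mul, ← hu, Units.inv_mul, C_1, one_mul]
  rw [hX] at h'
  exact h'

/-- **ASCENT for the double cover**: `c̄ = π c ∈ caⁿ(S/(f)) ⇒ c ∈ ca(S[y]/(y² + f))` — precisely `c ∈ caᵈ⁺ⁿ⁺²` — for `f ∈ S⁰`,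
`2 ∈ Sˣ`, `caᵈ⁺²(S[X]) = ⊤` (`…KC3LowerMiddle.mem_cohomologyAnnihilatorOfDegree_of_surjective` ← QuotientAscent p531707). [OURS · L1 w44b] -/
theorem mem_cohomologyAnnihilatorOfDegree_of_map_mem [IsNoetherianRing S] [Nontrivial S] (f : S) (hf : f ∈ S⁰) {d n : ℕ}
    (hSX : cohomologyAnnihilatorOfDegree (Polynomial S) (d + 2) = ⊤) (h2 : IsUnit (2 : S)) {c : AdjoinRoot (X ^ 2 + C f : S[X])}
    (hc : AdjoinRoot.lift (Ideal.Quotient.mk (Ideal.span {f})) (0 : S ⧸ Ideal.span {f})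
        (by rw [eval₂_add, eval₂_X_pow, eval₂_C, zero_pow (by omega), zero_add,
              Ideal.Quotient.eq_zero_iff_mem]; exact Ideal.mem_span_singleton_self f) c ∈
      cohomologyAnnihilatorOfDegree (S ⧸ Ideal.span {f}) n) :
    c ∈ cohomologyAnnihilatorOfDegree (AdjoinRoot (X ^ 2 + C f : S[X])) (d + n + 2) := by
  set π := (AdjoinRoot.lift (Ideal.Quotient.mk (Ideal.span {f})) (0 : S ⧸ Ideal.span {f})
    (by rw [eval₂_add, eval₂_X_pow, eval₂_C, zero_pow (by omega), zero_add,
          Ideal.Quotient.eq_zero_iff_mem]; exact Ideal.mem_span_singleton_self f) :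
      AdjoinRoot (X ^ 2 + C f : S[X]) →+* S ⧸ Ideal.span {f}) with hπ
  have hsurj : Function.Surjective π := fun u => by
    obtain ⟨s, rfl⟩ := Ideal.Quotient.mk_surjective u
    exact ⟨AdjoinRoot.of _ s, by rw [hπ, AdjoinRoot.lift_of]⟩
  exact mem_cohomologyAnnihilatorOfDegree_of_surjective π hsurj (ker_lift_eq f le_rfl) (root_mem_nonZeroDivisors f hf le_rfl)
    (m := d + n) (cohomologyAnnihilatorOfDegree_mono (by omega) (root_mem_cohomologyAnnihilatorOfDegree f hSX h2))
    (cohomologyAnnihilatorOfDegree_mono (by omega) hc)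

/-- **THEOREM DP for the double cover, both halves, fact-free: `ca(S[y]/(y² + f)) = π⁻¹(ca(S/(f)))`** (`f ∈ S⁰`, `2 ∈ Sˣ`,
`S[X]` of finite global dimension in the sense `caᵈ⁺²(S[X]) = ⊤`). [OURS · L1 w44b; Esentepe 2020 Thm 5.4 (m = 2), polynomial form] -/
theorem cohomologyAnnihilator_eq_comap [IsNoetherianRing S] [Nontrivial S] (f : S) (hf : f ∈ S⁰) {d : ℕ}
    (hSX : cohomologyAnnihilatorOfDegree (Polynomial S) (d + 2) = ⊤) (h2 : IsUnit (2 : S)) :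
    cohomologyAnnihilator (AdjoinRoot (X ^ 2 + C f : S[X])) =
      (cohomologyAnnihilator (S ⧸ Ideal.span {f})).comap
        (AdjoinRoot.lift (Ideal.Quotient.mk (Ideal.span {f})) (0 : S ⧸ Ideal.span {f})
          (by rw [eval₂_add, eval₂_X_pow, eval₂_C, zero_pow (by omega), zero_add,
                Ideal.Quotient.eq_zero_iff_mem]; exact Ideal.mem_span_singleton_self f)) := by
  apply le_antisymm
  · rw [← Ideal.map_le_iff_le_comap]
    exact map_cohomologyAnnihilator_le_quotient f hf le_rfl
  · intro c hc
    rw [Ideal.mem_comap, mem_cohomologyAnnihilator_iff] at hc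
    obtain ⟨n, hn⟩ := hc
    exact cohomologyAnnihilatorOfDegree_le _ (mem_cohomologyAnnihilatorOfDegree_of_map_mem f hf hSX h2 hn)

/-- … and `π(ca(S[y]/(y² + f))) = ca(S/(f))`. [OURS · L1 w44b] -/
theorem map_cohomologyAnnihilator_eq_quotient [IsNoetherianRing S] [Nontrivial S] (f : S) (hf : f ∈ S⁰) {d : ℕ}
    (hSX : cohomologyAnnihilatorOfDegree (Polynomial S) (d + 2) = ⊤) (h2 : IsUnit (2 : S)) :
    (cohomologyAnnihilator (AdjoinRoot (X ^ 2 + C f : S[X]))).map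
        (AdjoinRoot.lift (Ideal.Quotient.mk (Ideal.span {f})) (0 : S ⧸ Ideal.span {f})
          (by rw [eval₂_add, eval₂_X_pow, eval₂_C, zero_pow (by omega), zero_add,
                Ideal.Quotient.eq_zero_iff_mem]; exact Ideal.mem_span_singleton_self f)) =
      cohomologyAnnihilator (S ⧸ Ideal.span {f}) := by
  refine le_antisymm (map_cohomologyAnnihilator_le_quotient f hf le_rfl) fun c hc => ?_
  set π := (AdjoinRoot.lift (Ideal.Quotient.mk (Ideal.span {f})) (0 : S ⧸ Ideal.span {f})
    (by rw [eval₂_add, eval₂_X_pow, eval₂_C, zero_pow (by omega), zero_add,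
          Ideal.Quotient.eq_zero_iff_mem]; exact Ideal.mem_span_singleton_self f) :
      AdjoinRoot (X ^ 2 + C f : S[X]) →+* S ⧸ Ideal.span {f}) with hπ
  obtain ⟨s, rfl⟩ := Ideal.Quotient.mk_surjective c
  have hs : π (AdjoinRoot.of _ s) = Ideal.Quotient.mk (Ideal.span {f}) s := by rw [hπ, AdjoinRoot.lift_of]
  rw [← hs]
  refine Ideal.mem_map_of_mem _ ?_
  rw [cohomologyAnnihilator_eq_comap f hf hSX h2, Ideal.mem_comap, hs]
  exact hc

end Summit.ResolutionOfSingularities.ResolutionOfSingularities.Theorems.HomologicalConductor.BranchedCoverDescent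

end
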